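import Summits.PneNP.PneNP.Theses.KarlinRubin
import Summits.PneNP.PneNP.Theorems.KarlinRubinMonotoneBlindDnfPlanted
import Literature.Computability.Complexity.GnpPlantedLikelihoodRatio
import Literature.Probability.Moments.HoeffdingPMF

/-!
# Crux `MonotoneBlind` (stmt-PneNP-18027, route KarlinRubin), line `Sketch`: stub `stub_smallCliqueInvisible`

The information-theoretic LOWER half of the planted-clique threshold `2 log₂ n`: a clique planted on a uniformly
random vertex set of size `b n ≤ (2 - ε) log₂ n` is invisible to EVERY test `f n : EdgeVec n → Bool` (no monotonicity,
no size bound) — planted and null acceptance differ by `εs n → 0` in both directions (`stub_smallCliqueInvisible`;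
in the line's framework it supplies free negatives for the vertex-set form of the hard stub). Second-moment method:
* `smallClique_null_toReal_eq_sum`, `smallClique_planted_toReal_eq_sum` — both acceptance probabilities as
  `gnpWeight n (1/2)`-weighted sums (`G(n,1/2)` is uniform, `card_edgeVec`; `plant A x = x ⊔ cliqueVec A`);
* `smallClique_sq_plantSum_sub_le` — planting identity + Cauchy–Schwarz (`sq_sum_adv_le` at `q = 1/2`, planted
  family `K_A`, `A ∈ kSubsets n k`): `(#kSubsets · (planted - null))² ≤ Σ_{A,A'} (2^{e(K_A ∩ K_{A'})} - 1)`;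
* `smallClique_sum_sum_overlap_le` — `e(K_A ∩ K_{A'}) = C(|A ∩ A'|, 2)` and the overlap tail of two uniform `d`-sets
  (`d = min k n`; `card_kSubsets_filter_le_card_inter_mul_le`): `(planted - null)² ≤ Σ_{j ≤ d} (2^{C(j,2)} - 1) C(d,j) (d/n)^j`;
* `smallClique_overlapSum_le`, `smallClique_abs_planted_sub_null_le` — with `r = d² √2^d / n ≤ 1` every term is
  `≤ r^j ≤ r²` (`2^{C(j,2)} ≤ (√2^d)^j`, `C(d,j) ≤ d^j`), so `|planted - null| ≤ (d+1)³ √2^d / n` (all `n ≥ 1`, `k`, `f`);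
* `smallClique_eventually_rate` — eventually every `d ≤ (2-ε) log₂ n` has `(d+1)³ √2^d / n ≤ n^{-ε/4}`
  (`√2^d = 2^{d/2} ≤ n^{1-ε/2}`, `(log n)³ = o(n^{ε/4})`).

All `--supports stmt-PneNP-18027`; no definitions.
-/
set_option linter.dupNamespace false -- `Summit.PneNP.PneNP.…` is the layout-mandated namespace

namespace Summit.PneNP.PneNP.Theorems.MonotoneBlind.VertexCover

open Literature.Computability.Complexity Literature.Probability.RandomGraphs.PlantedClique Filter Finset
open scoped ENNReal Topology Classical

variable {n : ℕ}

/-! ### `G(n,1/2)` and the planted law as `gnpWeight`-sums -/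

/-- At density `1/2` every edge vector has `G(n,q)`-weight `2^{-C(n,2)}`. [folklore] -/
theorem smallClique_gnpWeight_half (x : EdgeVec n) : gnpWeight n (1 / 2) x = 1 / 2 ^ (n.choose 2) := by
  have hle : edgeCount x ≤ n.choose 2 := by
    unfold edgeCount
    calc #(univ.filter fun e => x e = true) ≤ #(univ : Finset ((⊤ : SimpleGraph (Fin n)).edgeSet)) :=
          card_filter_le _ _
      _ = n.choose 2 := by rw [card_univ]; convert card_edgeSet_top_fin n
  unfold gnpWeight
  rw [show (1 : ℝ) - 1 / 2 = 1 / 2 by norm_num, ← pow_add, Nat.add_sub_cancel' hle, one_div_pow]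

/-- `G(n,1/2)`-probabilities as `gnpWeight n (1/2)`-weighted sums: `Pr[S] = Σ_x w(x) · 1[x ∈ S]`. [folklore] -/
theorem smallClique_toReal_eq_sum_gnpWeight (S : Set (EdgeVec n)) [DecidablePred (· ∈ S)] :
    ((erdosRenyiHalf n).toOuterMeasure S).toReal =
      ∑ x : EdgeVec n, gnpWeight n (1 / 2) x * (if x ∈ S then (1 : ℝ) else 0) := by
  rw [erdosRenyiHalf_toOuterMeasure_eq_card_div S, ENNReal.toReal_div, ENNReal.toReal_natCast,
    ENNReal.toReal_natCast, Literature.Probability.RandomGraphs.card_edgeVec]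
  simp_rw [smallClique_gnpWeight_half]
  rw [← mul_sum, sum_boole]
  push_cast
  ring

/-- The null acceptance probability of a test as a weighted sum. [folklore] -/
theorem smallClique_null_toReal_eq_sum (g : EdgeVec n → Bool) :
    ((erdosRenyiHalf n).toOuterMeasure {x | g x = true}).toReal =
      ∑ x : EdgeVec n, gnpWeight n (1 / 2) x * (if g x = true then (1 : ℝ) else 0) := by
  rw [smallClique_toReal_eq_sum_gnpWeight]
  simp only [Set.mem_setOf_eq]

/-- Planting a clique on `A` is the join with the clique vector `K_A`. [folklore] -/
theorem smallClique_plant_eq_sup (A : Finset (Fin n)) (x : EdgeVec n) : plant A x = x ⊔ cliqueVec A := by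
  funext e
  rw [sup_apply_bool, Bool.eq_iff_iff, plant_apply_eq_true_iff, Bool.or_eq_true]
  simp only [cliqueVec, decide_eq_true_eq]

/-- The planted acceptance probability of a test as an average, over the planted set, of weighted sums. [folklore] -/
theorem smallClique_planted_toReal_eq_sum (k : ℕ) (f : EdgeVec n → Bool) :
    ((plantedCliqueDist n k).toOuterMeasure {y | f y = true}).toReal =
      (#(kSubsets n k) : ℝ)⁻¹ * ∑ A ∈ kSubsets n k,
        ∑ x : EdgeVec n, gnpWeight n (1 / 2) x * (if f (x ⊔ cliqueVec A) = true then (1 : ℝ) else 0) := by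
  rw [plantedCliqueDist_toOuterMeasure_eq_sum, ENNReal.toReal_mul, ENNReal.toReal_inv, ENNReal.toReal_natCast,
    ENNReal.toReal_sum]
  · congr 1
    refine sum_congr rfl fun A _ => ?_
    have hset : {x : EdgeVec n | plant A x ∈ {y : EdgeVec n | f y = true}} = {x | f (x ⊔ cliqueVec A) = true} := by
      ext x; simp only [Set.mem_setOf_eq, smallClique_plant_eq_sup]
    rw [hset]
    exact smallClique_null_toReal_eq_sum _
  · exact fun A _ => Literature.Probability.Moments.pmf_toOuterMeasure_ne_top _ _

/-! ### Planting identity and Cauchy–Schwarz -/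

/-- **Squared advantage ≤ second moment** for the planted cliques `K_A`, `A ∈ P`, under `G(n,1/2)` and a test
`f`: `(Σ_A E[f(x ∪ K_A)] - #P · E[f])² ≤ Σ_{A,A'} (2^{e(K_A ∩ K_{A'})} - 1)` — the planting identity
`E[f(x ∪ K_A)] = E[L_A f]` (`sum_gnpWeight_mul_sup_eq_sum_lr`) and Cauchy–Schwarz (`sq_sum_adv_le`) at `q = 1/2`.
[folklore] -/
theorem smallClique_sq_plantSum_sub_le (P : Finset (Finset (Fin n))) (f : EdgeVec n → Bool) :
    (∑ A ∈ P, ∑ x : EdgeVec n, gnpWeight n (1 / 2) x * (if f (x ⊔ cliqueVec A) = true then (1 : ℝ) else 0) -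
        (#P : ℝ) * ∑ x : EdgeVec n, gnpWeight n (1 / 2) x * (if f x = true then (1 : ℝ) else 0)) ^ 2 ≤
      ∑ A ∈ P, ∑ A' ∈ P, ((2 : ℝ) ^ edgeCount (cliqueVec A ⊓ cliqueVec A') - 1) := by
  have hq : (1 / 2 : ℝ) ≠ 0 := by norm_num
  have hid := sum_mul_sum_sub_eq P (gnpWeight n (1 / 2)) (fun x => if f x = true then (1 : ℝ) else 0)
    (fun A x => if f (x ⊔ cliqueVec A) = true then (1 : ℝ) else 0)
    (fun A x => ((1 / 2 : ℝ) ^ edgeCount (cliqueVec A))⁻¹ * if cliqueVec A ≤ x then 1 else 0)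
    (fun A _ => sum_gnpWeight_mul_sup_eq_sum_lr hq (cliqueVec A) fun x => if f x = true then (1 : ℝ) else 0)
  have hcs := sq_sum_adv_le P cliqueVec (q := (1 / 2 : ℝ)) (by norm_num) (by norm_num) (fun x => f x = true)
  beta_reduce at hid
  have h1 : ∑ x : EdgeVec n, ∑ A ∈ P, gnpWeight n (1 / 2) x * (if f (x ⊔ cliqueVec A) = true then (1 : ℝ) else 0) =
      ∑ A ∈ P, ∑ x : EdgeVec n, gnpWeight n (1 / 2) x * (if f (x ⊔ cliqueVec A) = true then (1 : ℝ) else 0) :=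
    sum_comm
  have h2 : ∑ x : EdgeVec n, ∑ _A ∈ P, gnpWeight n (1 / 2) x * (if f x = true then (1 : ℝ) else 0) =
      (#P : ℝ) * ∑ x : EdgeVec n, gnpWeight n (1 / 2) x * (if f x = true then (1 : ℝ) else 0) := by
    rw [mul_sum]
    exact sum_congr rfl fun x _ => by rw [sum_const, nsmul_eq_mul]
  have hre : (∑ A ∈ P, ∑ x : EdgeVec n, gnpWeight n (1 / 2) x *
          (if f (x ⊔ cliqueVec A) = true then (1 : ℝ) else 0) -
        (#P : ℝ) * ∑ x : EdgeVec n, gnpWeight n (1 / 2) x * (if f x = true then (1 : ℝ) else 0)) =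
      ∑ x : EdgeVec n, gnpWeight n (1 / 2) x * ∑ A ∈ P,
        ((if f (x ⊔ cliqueVec A) = true then (1 : ℝ) else 0) - if f x = true then (1 : ℝ) else 0) := by
    rw [← h1, ← h2, ← sum_sub_distrib]
    refine sum_congr rfl fun x _ => ?_
    rw [mul_sum, ← sum_sub_distrib]
    refine sum_congr rfl fun A _ => ?_
    ring
  rw [hre, hid]
  refine hcs.trans_eq ?_
  simp only [one_div, inv_pow, inv_inv]

/-! ### The overlap of two uniform `d`-subsets -/

/-- `K_A ∩ K_B = K_{A ∩ B}` as edge vectors. [folklore] -/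
theorem smallClique_cliqueVec_inf (A B : Finset (Fin n)) : cliqueVec A ⊓ cliqueVec B = cliqueVec (A ∩ B) := by
  funext e
  rw [inf_apply_bool, Bool.eq_iff_iff, Bool.and_eq_true]
  simp only [cliqueVec, decide_eq_true_eq, mem_inter]
  exact ⟨fun h v hv => ⟨h.1 v hv, h.2 v hv⟩, fun h => ⟨fun v hv => (h v hv).1, fun v hv => (h v hv).2⟩⟩

/-- `e(K_A) = C(|A|, 2)`. [folklore] -/
theorem smallClique_edgeCount_cliqueVec (A : Finset (Fin n)) : edgeCount (cliqueVec A) = (#A).choose 2 :=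
  card_filter_cliqueVec A

/-- **Second moment of the overlap.** For `d = min k n` and `0 < n`:
`Σ_{A,A' ∈ kSubsets} (2^{e(K_A ∩ K_{A'})} - 1) ≤ #kSubsets² · Σ_{j ≤ d} (2^{C(j,2)} - 1) C(d,j) (d/n)^j`, from
`e(K_A ∩ K_{A'}) = C(|A ∩ A'|, 2)`, `φ(|A' ∩ A|) ≤ Σ_j [j ≤ |A' ∩ A|] φ(j)` for the nonnegative
`φ(j) = 2^{C(j,2)} - 1`, and the union-bound tail `#{A' : j ≤ |A' ∩ A|} · n^j ≤ #kSubsets · C(d,j) d^j`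
(`card_kSubsets_filter_le_card_inter_mul_le`). [folklore] -/
theorem smallClique_sum_sum_overlap_le (hn : 0 < n) (k : ℕ) :
    ∑ A ∈ kSubsets n k, ∑ A' ∈ kSubsets n k, ((2 : ℝ) ^ edgeCount (cliqueVec A ⊓ cliqueVec A') - 1) ≤
      (#(kSubsets n k) : ℝ) ^ 2 * ∑ j ∈ range (min k n + 1),
        ((2 : ℝ) ^ (j.choose 2) - 1) * (((min k n).choose j : ℕ) : ℝ) * (((min k n : ℕ) : ℝ) / n) ^ j := by
  have hφ : ∀ j : ℕ, (0 : ℝ) ≤ (2 : ℝ) ^ (j.choose 2) - 1 := fun j => sub_nonneg.2 (one_le_pow₀ (by norm_num))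
  have hA : ∀ A ∈ kSubsets n k,
      ∑ A' ∈ kSubsets n k, ((2 : ℝ) ^ edgeCount (cliqueVec A ⊓ cliqueVec A') - 1) ≤
        (#(kSubsets n k) : ℝ) * ∑ j ∈ range (min k n + 1),
          ((2 : ℝ) ^ (j.choose 2) - 1) * (((min k n).choose j : ℕ) : ℝ) * (((min k n : ℕ) : ℝ) / n) ^ j := by
    intro A hAKS
    have hcardA : #A = min k n := card_of_mem_kSubsets hAKS
    have hover : ∀ A' ∈ kSubsets n k, ((2 : ℝ) ^ edgeCount (cliqueVec A ⊓ cliqueVec A') - 1) =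
        (2 : ℝ) ^ ((#(A' ∩ A)).choose 2) - 1 := by
      intro A' _
      rw [smallClique_cliqueVec_inf, smallClique_edgeCount_cliqueVec, inter_comm]
    rw [sum_congr rfl hover]
    have hstep : ∀ A' ∈ kSubsets n k, (2 : ℝ) ^ ((#(A' ∩ A)).choose 2) - 1 ≤
        ∑ j ∈ range (min k n + 1), if j ≤ #(A' ∩ A) then (2 : ℝ) ^ (j.choose 2) - 1 else 0 := by
      intro A' _
      have hm : #(A' ∩ A) ∈ range (min k n + 1) := by
        rw [mem_range, Nat.lt_succ_iff, ← hcardA]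
        exact card_le_card inter_subset_right
      have h := single_le_sum (s := range (min k n + 1))
        (f := fun j => if j ≤ #(A' ∩ A) then (2 : ℝ) ^ (j.choose 2) - 1 else 0)
        (fun j _ => by split_ifs; exacts [hφ j, le_rfl]) hm
      rwa [if_pos le_rfl] at h
    calc ∑ A' ∈ kSubsets n k, ((2 : ℝ) ^ ((#(A' ∩ A)).choose 2) - 1)
        ≤ ∑ A' ∈ kSubsets n k, ∑ j ∈ range (min k n + 1),
            (if j ≤ #(A' ∩ A) then (2 : ℝ) ^ (j.choose 2) - 1 else 0) := sum_le_sum hstep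
      _ = ∑ j ∈ range (min k n + 1), ((2 : ℝ) ^ (j.choose 2) - 1) *
            (#((kSubsets n k).filter fun A' => j ≤ #(A' ∩ A)) : ℝ) := by
          rw [sum_comm]
          refine sum_congr rfl fun j _ => ?_
          rw [← sum_filter, sum_const, nsmul_eq_mul, mul_comm]
      _ ≤ ∑ j ∈ range (min k n + 1), ((2 : ℝ) ^ (j.choose 2) - 1) *
            ((#(kSubsets n k) : ℝ) * (((min k n).choose j : ℕ) : ℝ) * (((min k n : ℕ) : ℝ) / n) ^ j) := by
          refine sum_le_sum fun j _ => mul_le_mul_of_nonneg_left ?_ (hφ j)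
          have hc := card_kSubsets_filter_le_card_inter_mul_le A k j
          rw [hcardA, ← mul_assoc] at hc
          have hnj : (0 : ℝ) < (n : ℝ) ^ j := by positivity
          rw [div_pow, ← mul_div_assoc, le_div_iff₀ hnj]
          exact_mod_cast hc
      _ = (#(kSubsets n k) : ℝ) * ∑ j ∈ range (min k n + 1),
            ((2 : ℝ) ^ (j.choose 2) - 1) * (((min k n).choose j : ℕ) : ℝ) * (((min k n : ℕ) : ℝ) / n) ^ j := by
          rw [mul_sum]
          exact sum_congr rfl fun j _ => by ring
  calc ∑ A ∈ kSubsets n k, ∑ A' ∈ kSubsets n k, ((2 : ℝ) ^ edgeCount (cliqueVec A ⊓ cliqueVec A') - 1)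
      ≤ ∑ _A ∈ kSubsets n k, (#(kSubsets n k) : ℝ) * ∑ j ∈ range (min k n + 1),
          ((2 : ℝ) ^ (j.choose 2) - 1) * (((min k n).choose j : ℕ) : ℝ) * (((min k n : ℕ) : ℝ) / n) ^ j :=
        sum_le_sum hA
    _ = _ := by rw [sum_const, nsmul_eq_mul]; ring

/-- **The overlap sum is small.** With `r = d² √2^d / n ≤ 1`: every term of
`Σ_{j ≤ d} (2^{C(j,2)} - 1) C(d,j) (d/n)^j` is `0` (`j ≤ 1`) or `≤ r^j ≤ r²` (`2^{C(j,2)} ≤ (√2^d)^j` as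
`2 C(j,2) ≤ d j`, and `C(d,j) ≤ d^j`), so the sum is `≤ (d+1) r²`. [folklore] -/
theorem smallClique_overlapSum_le (d : ℕ) (hr : (d : ℝ) ^ 2 * Real.sqrt 2 ^ d / n ≤ 1) :
    ∑ j ∈ range (d + 1), ((2 : ℝ) ^ (j.choose 2) - 1) * ((d.choose j : ℕ) : ℝ) * ((d : ℝ) / n) ^ j ≤
      ((d : ℝ) + 1) * ((d : ℝ) ^ 2 * Real.sqrt 2 ^ d / n) ^ 2 := by
  have hr0 : 0 ≤ (d : ℝ) ^ 2 * Real.sqrt 2 ^ d / n := by positivity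
  have hs1 : (1 : ℝ) ≤ Real.sqrt 2 := Real.one_le_sqrt.2 (by norm_num)
  have hterm : ∀ j ∈ range (d + 1),
      ((2 : ℝ) ^ (j.choose 2) - 1) * ((d.choose j : ℕ) : ℝ) * ((d : ℝ) / n) ^ j ≤
        ((d : ℝ) ^ 2 * Real.sqrt 2 ^ d / n) ^ 2 := by
    intro j hj
    have hjd : j ≤ d := Nat.lt_succ_iff.1 (mem_range.1 hj)
    rcases lt_or_ge j 2 with hj2 | hj2
    · rw [Nat.choose_eq_zero_of_lt hj2, pow_zero, sub_self, zero_mul, zero_mul]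
      positivity
    · have h2C : 2 * j.choose 2 ≤ d * j := by
        rw [Nat.choose_two_right, mul_comm 2]
        calc j * (j - 1) / 2 * 2 ≤ j * (j - 1) := Nat.div_mul_le_self _ _
          _ ≤ j * d := Nat.mul_le_mul_left j (by omega)
          _ = d * j := mul_comm _ _
      have h1 : (2 : ℝ) ^ (j.choose 2) - 1 ≤ (Real.sqrt 2 ^ d) ^ j :=
        calc (2 : ℝ) ^ (j.choose 2) - 1 ≤ (2 : ℝ) ^ (j.choose 2) := sub_le_self _ zero_le_one
          _ = Real.sqrt 2 ^ (2 * j.choose 2) := by rw [pow_mul, Real.sq_sqrt (by norm_num : (0 : ℝ) ≤ 2)]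
          _ ≤ Real.sqrt 2 ^ (d * j) := pow_le_pow_right₀ hs1 h2C
          _ = (Real.sqrt 2 ^ d) ^ j := pow_mul _ _ _
      have h2 : ((d.choose j : ℕ) : ℝ) ≤ (d : ℝ) ^ j := by exact_mod_cast Nat.choose_le_pow d j
      calc ((2 : ℝ) ^ (j.choose 2) - 1) * ((d.choose j : ℕ) : ℝ) * ((d : ℝ) / n) ^ j
          ≤ (Real.sqrt 2 ^ d) ^ j * (d : ℝ) ^ j * ((d : ℝ) / n) ^ j :=
            mul_le_mul_of_nonneg_right (mul_le_mul h1 h2 (Nat.cast_nonneg _) (by positivity)) (by positivity)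
        _ = ((d : ℝ) ^ 2 * Real.sqrt 2 ^ d / n) ^ j := by rw [← mul_pow, ← mul_pow]; congr 1; ring
        _ ≤ ((d : ℝ) ^ 2 * Real.sqrt 2 ^ d / n) ^ 2 := pow_le_pow_of_le_one hr0 hr hj2
  calc ∑ j ∈ range (d + 1), ((2 : ℝ) ^ (j.choose 2) - 1) * ((d.choose j : ℕ) : ℝ) * ((d : ℝ) / n) ^ j
      ≤ ∑ _j ∈ range (d + 1), ((d : ℝ) ^ 2 * Real.sqrt 2 ^ d / n) ^ 2 := sum_le_sum hterm
    _ = ((d : ℝ) + 1) * ((d : ℝ) ^ 2 * Real.sqrt 2 ^ d / n) ^ 2 := by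
        rw [sum_const, card_range, nsmul_eq_mul, Nat.cast_succ]

/-- If `p₀, p₁ ∈ [0,1]`, `(p₁ - p₀)² ≤ T` and `T ≤ (d+1) r²` whenever `r ≤ 1` (`r, d ≥ 0`), then
`|p₁ - p₀| ≤ (d+1) r` (for `r > 1` trivially). [folklore] -/
theorem smallClique_abs_sub_le_of_sq_le {p₀ p₁ T r d : ℝ} (hp₀ : 0 ≤ p₀) (hp₀' : p₀ ≤ 1) (hp₁ : 0 ≤ p₁)
    (hp₁' : p₁ ≤ 1) (hd : 0 ≤ d) (hr : 0 ≤ r) (hsq : (p₁ - p₀) ^ 2 ≤ T)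
    (hT : r ≤ 1 → T ≤ (d + 1) * r ^ 2) : |p₁ - p₀| ≤ (d + 1) * r := by
  rcases le_or_gt r 1 with hr1 | hr1
  · refine abs_le_of_sq_le_sq ?_ (by positivity)
    have hd1 : d + 1 ≤ (d + 1) ^ 2 := by nlinarith
    calc (p₁ - p₀) ^ 2 ≤ T := hsq
      _ ≤ (d + 1) * r ^ 2 := hT hr1
      _ ≤ (d + 1) ^ 2 * r ^ 2 := mul_le_mul_of_nonneg_right hd1 (sq_nonneg r)
      _ = ((d + 1) * r) ^ 2 := by ring
  · have h1 : |p₁ - p₀| ≤ 1 := by rw [abs_le]; constructor <;> linarith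
    calc |p₁ - p₀| ≤ 1 := h1
      _ ≤ r := hr1.le
      _ ≤ (d + 1) * r := le_mul_of_one_le_left hr (by linarith)

/-- **Small planted cliques are invisible, quantitatively.** For every `n ≥ 1`, `k` and test `f`, with
`d = min k n`: `|Pr_{G(n,1/2,k)}[f] - Pr_{G(n,1/2)}[f]| ≤ (d+1)³ √2^d / n`. [folklore] -/
theorem smallClique_abs_planted_sub_null_le (hn : 0 < n) (k : ℕ) (f : EdgeVec n → Bool) :
    |((plantedCliqueDist n k).toOuterMeasure {y | f y = true}).toReal -
        ((erdosRenyiHalf n).toOuterMeasure {x | f x = true}).toReal| ≤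
      ((min k n + 1 : ℕ) : ℝ) ^ 3 * Real.sqrt 2 ^ (min k n) / n := by
  have hM : (0 : ℝ) < #(kSubsets n k) := by exact_mod_cast (kSubsets_nonempty n k).card_pos
  have hp1 := smallClique_planted_toReal_eq_sum k f
  have hp0 := smallClique_null_toReal_eq_sum f
  have hA := smallClique_sq_plantSum_sub_le (kSubsets n k) f
  have hB := smallClique_sum_sum_overlap_le hn k
  have hS : ∑ A ∈ kSubsets n k, ∑ x : EdgeVec n, gnpWeight n (1 / 2) x *
      (if f (x ⊔ cliqueVec A) = true then (1 : ℝ) else 0) =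
      (#(kSubsets n k) : ℝ) * ((plantedCliqueDist n k).toOuterMeasure {y | f y = true}).toReal := by
    rw [hp1, mul_inv_cancel_left₀ hM.ne']
  rw [hS, ← hp0, ← mul_sub, mul_pow] at hA
  have hsq := le_of_mul_le_mul_left (hA.trans hB) (pow_pos hM 2)
  have hfin := smallClique_abs_sub_le_of_sq_le
    (p₀ := ((erdosRenyiHalf n).toOuterMeasure {x | f x = true}).toReal)
    (p₁ := ((plantedCliqueDist n k).toOuterMeasure {y | f y = true}).toReal)
    ENNReal.toReal_nonneg (Literature.Probability.Moments.pmf_toReal_toOuterMeasure_le_one _ _) ENNReal.toReal_nonneg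
    (Literature.Probability.Moments.pmf_toReal_toOuterMeasure_le_one _ _) (Nat.cast_nonneg (min k n))
    (by positivity : (0 : ℝ) ≤ ((min k n : ℕ) : ℝ) ^ 2 * Real.sqrt 2 ^ (min k n) / n) hsq
    (smallClique_overlapSum_le (n := n) (min k n))
  refine hfin.trans ?_
  generalize min k n = d
  rw [Nat.cast_succ, mul_div_assoc']
  refine div_le_div_of_nonneg_right ?_ (Nat.cast_nonneg n)
  calc ((d : ℝ) + 1) * ((d : ℝ) ^ 2 * Real.sqrt 2 ^ d)
      ≤ ((d : ℝ) + 1) * ((d : ℝ) ^ 2 * Real.sqrt 2 ^ d) + ((d : ℝ) + 1) * Real.sqrt 2 ^ d * (2 * d + 1) :=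
        le_add_of_nonneg_right (by positivity)
    _ = ((d : ℝ) + 1) ^ 3 * Real.sqrt 2 ^ d := by ring

/-! ### Asymptotics and assembly -/

/-- **The rate.** For `0 < ε`, eventually in `n`: every `d ≤ (2 - ε) log₂ n` has
`(d+1)³ √2^d / n ≤ n^{-ε/4}` (`d + 1 ≤ 6 log n`, `(log n)³ ≤ n^{ε/4} / 216` eventually,
`√2^d = 2^{d/2} ≤ n^{1 - ε/2}`). [folklore] -/
theorem smallClique_eventually_rate {ε : ℝ} (hε : 0 < ε) :
    ∀ᶠ n : ℕ in atTop, ∀ d : ℕ, (d : ℝ) ≤ (2 - ε) * Real.logb 2 n →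
      ((d + 1 : ℕ) : ℝ) ^ 3 * Real.sqrt 2 ^ d / n ≤ (n : ℝ) ^ (-(ε / 4)) := by
  have hlo := (isLittleO_log_rpow_atTop (by positivity : 0 < ε / 12)).pow (by norm_num : 0 < 3)
  have hev := (hlo.comp_tendsto tendsto_natCast_atTop_atTop).def (show (0 : ℝ) < 1 / 216 by norm_num)
  filter_upwards [hev, eventually_ge_atTop 2] with n hlog hn2 d hd
  have hn0 : 0 < n := by omega
  have hnR : (0 : ℝ) < n := by exact_mod_cast hn0
  have hn1 : (1 : ℝ) ≤ n := by exact_mod_cast hn0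
  have hlog3 : Real.log n ^ 3 ≤ 1 / 216 * (n : ℝ) ^ (ε / 4) := by
    have h := hlog
    simp only [Function.comp, Real.norm_eq_abs] at h
    rw [abs_of_nonneg (pow_nonneg (Real.log_nonneg hn1) 3), abs_of_nonneg (by positivity)] at h
    have hpow : ((n : ℝ) ^ (ε / 12)) ^ 3 = (n : ℝ) ^ (ε / 4) := by
      rw [← Real.rpow_natCast, ← Real.rpow_mul hnR.le]; congr 1; push_cast; ring
    rwa [hpow] at h
  have hlog2 : (1 : ℝ) / 2 < Real.log 2 := by linarith [Real.log_two_gt_d9]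
  have hlogn : Real.log 2 ≤ Real.log n := Real.log_le_log two_pos (by exact_mod_cast hn2)
  have hL0 : 0 ≤ Real.logb 2 n := Real.logb_nonneg one_lt_two hn1
  have hL : Real.logb 2 n ≤ 2 * Real.log n := by
    rw [Real.logb, div_le_iff₀ (by linarith)]
    nlinarith [Real.log_nonneg hn1]
  have hd2 : (d : ℝ) ≤ 2 * Real.logb 2 n := by linarith [mul_nonneg hε.le hL0]
  have hd1 : ((d + 1 : ℕ) : ℝ) ≤ 6 * Real.log n := by push_cast; linarith
  have hA : ((d + 1 : ℕ) : ℝ) ^ 3 ≤ (n : ℝ) ^ (ε / 4) := by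
    calc ((d + 1 : ℕ) : ℝ) ^ 3 ≤ (6 * Real.log n) ^ 3 := by gcongr
      _ = 216 * Real.log n ^ 3 := by ring
      _ ≤ 216 * (1 / 216 * (n : ℝ) ^ (ε / 4)) := by gcongr
      _ = (n : ℝ) ^ (ε / 4) := by ring
  have hS : Real.sqrt 2 ^ d ≤ (n : ℝ) ^ (1 - ε / 2) := by
    have h1 : Real.sqrt 2 ^ d = (2 : ℝ) ^ ((d : ℝ) / 2) := by
      rw [Real.sqrt_eq_rpow, ← Real.rpow_natCast, ← Real.rpow_mul (by norm_num : (0 : ℝ) ≤ 2)]; congr 1; ring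
    have h2 : (n : ℝ) ^ (1 - ε / 2) = (2 : ℝ) ^ (Real.logb 2 n * (1 - ε / 2)) := by
      rw [Real.rpow_mul (by norm_num : (0 : ℝ) ≤ 2), Real.rpow_logb two_pos (by norm_num) hnR]
    rw [h1, h2]
    refine Real.rpow_le_rpow_of_exponent_le (by norm_num : (1 : ℝ) ≤ 2) ?_
    linarith
  rw [div_le_iff₀ hnR]
  calc ((d + 1 : ℕ) : ℝ) ^ 3 * Real.sqrt 2 ^ d ≤ (n : ℝ) ^ (ε / 4) * (n : ℝ) ^ (1 - ε / 2) :=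
        mul_le_mul hA hS (by positivity) (by positivity)
    _ = (n : ℝ) ^ (-(ε / 4)) * n := by rw [← Real.rpow_add hnR, ← Real.rpow_add_one hnR.ne']; congr 1; ring

/-- `ofReal x ≤ ofReal y + ofReal |x - y|` for `y ≥ 0`. [folklore] -/
theorem smallClique_ofReal_le_add_abs {x y : ℝ} (hy : 0 ≤ y) :
    ENNReal.ofReal x ≤ ENNReal.ofReal y + ENNReal.ofReal |x - y| := by
  rw [← ENNReal.ofReal_add hy (abs_nonneg _)]
  exact ENNReal.ofReal_le_ofReal (by linarith [le_abs_self (x - y)])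

/-- Two finite `ℝ≥0∞` numbers differ, in either direction, by at most `ofReal` of the distance of their real
values. [folklore] -/
theorem smallClique_le_add_ofReal_abs {a b : ℝ≥0∞} (ha : a ≠ ⊤) (hb : b ≠ ⊤) :
    a ≤ b + ENNReal.ofReal |a.toReal - b.toReal| ∧ b ≤ a + ENNReal.ofReal |a.toReal - b.toReal| := by
  constructor
  · calc a = ENNReal.ofReal a.toReal := (ENNReal.ofReal_toReal ha).symm
      _ ≤ ENNReal.ofReal b.toReal + ENNReal.ofReal |a.toReal - b.toReal| :=
          smallClique_ofReal_le_add_abs ENNReal.toReal_nonneg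
      _ = b + ENNReal.ofReal |a.toReal - b.toReal| := by rw [ENNReal.ofReal_toReal hb]
  · calc b = ENNReal.ofReal b.toReal := (ENNReal.ofReal_toReal hb).symm
      _ ≤ ENNReal.ofReal a.toReal + ENNReal.ofReal |b.toReal - a.toReal| :=
          smallClique_ofReal_le_add_abs ENNReal.toReal_nonneg
      _ = a + ENNReal.ofReal |a.toReal - b.toReal| := by rw [ENNReal.ofReal_toReal ha, abs_sub_comm]

/-- **stub_smallCliqueInvisible** (the information-theoretic lower half of the `2 log₂ n` threshold). For every
`ε > 0`, every clique-size sequence with `b n ≤ (2 - ε) log₂ n` eventually and EVERY family of tests `f n` (no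
monotonicity, no size bound): the planted-`b n` acceptance and the null acceptance differ by `≤ εs n → 0` in both
directions. Proof: with `εs n := ofReal |planted - null|` both inequalities hold for every `n`
(`smallClique_le_add_ofReal_abs`), and `|planted - null| ≤ (d+1)³ √2^d / n ≤ n^{-ε/4} → 0` (`d = min (b n) n`;
`smallClique_abs_planted_sub_null_le` — planting identity + Cauchy–Schwarz `sq_sum_adv_le` at `q = 1/2`,
`adv² ≤ E_{B,B'}[2^{C(|B ∩ B'|,2)}] - 1`, overlap tail `Pr[|B ∩ B'| ≥ j] ≤ C(d,j) (d/n)^j` — and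
`smallClique_eventually_rate`, `2^{d/2} ≤ n^{1-ε/2}`). [cite: Kucera1995, §1] [folklore] -/
theorem stub_smallCliqueInvisible :
    ∀ ε : ℝ, 0 < ε → ∀ b : ℕ → ℕ, (∀ᶠ n : ℕ in atTop, (b n : ℝ) ≤ (2 - ε) * Real.logb 2 (n : ℝ)) →
      ∀ f : (n : ℕ) → EdgeVec n → Bool,
      ∃ εs : ℕ → ℝ≥0∞, Tendsto εs atTop (𝓝 0) ∧
        ∀ᶠ n : ℕ in atTop,
          (plantedCliqueDist n (b n)).toOuterMeasure {y | f n y = true} ≤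
              (erdosRenyiHalf n).toOuterMeasure {x | f n x = true} + εs n ∧
            (erdosRenyiHalf n).toOuterMeasure {x | f n x = true} ≤
              (plantedCliqueDist n (b n)).toOuterMeasure {y | f n y = true} + εs n := by
  intro ε hε b hb f
  refine ⟨fun n => ENNReal.ofReal
      |((plantedCliqueDist n (b n)).toOuterMeasure {y | f n y = true}).toReal -
        ((erdosRenyiHalf n).toOuterMeasure {x | f n x = true}).toReal|, ?_,
    Eventually.of_forall fun n => smallClique_le_add_ofReal_abs (Literature.Probability.Moments.pmf_toOuterMeasure_ne_top _ _)
      (Literature.Probability.Moments.pmf_toOuterMeasure_ne_top _ _)⟩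
  have hreal : Tendsto (fun n : ℕ =>
      |((plantedCliqueDist n (b n)).toOuterMeasure {y | f n y = true}).toReal -
        ((erdosRenyiHalf n).toOuterMeasure {x | f n x = true}).toReal|) atTop (𝓝 0) := by
    refine squeeze_zero' (Eventually.of_forall fun n => abs_nonneg _) ?_
      ((tendsto_rpow_neg_atTop (by positivity : 0 < ε / 4)).comp tendsto_natCast_atTop_atTop)
    filter_upwards [hb, smallClique_eventually_rate hε, eventually_gt_atTop 0] with n hbn hrate hn
    exact (smallClique_abs_planted_sub_null_le hn (b n) (f n)).trans
      (hrate (min (b n) n) ((by exact_mod_cast min_le_left _ _ : ((min (b n) n : ℕ) : ℝ) ≤ b n).trans hbn))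
  have h := ENNReal.tendsto_ofReal hreal
  rwa [ENNReal.ofReal_zero] at h

end Summit.PneNP.PneNP.Theorems.MonotoneBlind.VertexCover
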